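import Summits.CriticalPhenomena.PercolationContinuityZ3.Theorems.PercNearOneGluingNoHeavyConstsClusterSquareSeparated
import HarnessLib

/-!
# No double clash when, for every cluster `K` of `a`, the clash and branch vertices are separated

builds on p205010 (kernel theorem, internal audit signed; external expert review pending)

PAPER-2 track "percolation constants", part (ii), seat `prim-consts-1`, gen 17 (lane index
`run/shared/lean/prim/consts/CONSTANTS.md`, row A19; memo `FROM-prim-consts-1-g17-THREE-COPY-STRUCTURE.md` §2b).
Support file for the crux `NoHeavyLowerTail` (stmt-CriticalPhenomena-4575; `--supports`).  Theorems only; no sorries.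

The sharpest combinatorial criterion of this series for the no-double-clash hypothesis of `…ConstsClusterSquareNDCPos.lean`
(after `…ClusterSquareThin`, `…ClusterSquareSeparated`): it quantifies over the possible clusters `K` of `a`.  For configurations
`ω ∈ {a ↮ b, a ↮ c, b ↮ c}` and `η' = η ∖ (pairs meeting K)`, `K = C_a(ω)`, a double clash provides (`Consts.exists_branch_of_clash'`,
a sharpening of `Consts.exists_branch_of_clash` recording also the initial segment of the clash path): the cluster `K ∋ a` (connected
through `H`-edges inside `K`, `b, c ∉ K`); two distinct CLASH vertices `y ≠ y'` outside `K ∪ {a, b, c}`, each with a neighbour in `K`;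
two distinct BRANCH vertices `v ≠ v'` (at least three neighbours, outside `K ∪ {a, b, c}`, `v ≠ y'`, `v' ≠ y`) such that, in a graph `H`
carrying the positive pairs, `v ~ b` off `K ∪ {c, v', y'}` and `y ~ v` off `K ∪ {b, c, v', y'}` (inside `C_b(ω)`), `v ~ c` off
`K ∪ {b, v', y'}` (inside `C_c(η')`), and symmetrically `v' ~ c` off `K ∪ {b, v, y}`, `y' ~ v'` off `K ∪ {b, c, v, y}`, `v' ~ b` off
`K ∪ {c, v, y}`.  Hence (`Consts.not_doubleClash_of_clusterSeparated`) NDC holds as soon as, for every such `K, y, y', v, v'`, ONE of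
these six joinings is refuted by a closed-set certificate; CSQ, DUU at `(a; b, c)` and TS for `{a, b, c}` follow
(`Consts.clusterSquare_le_sq_of_clusterSeparated`, `Consts.sq_real_split_le_of_clusterSeparated`, `Consts.tripleSplit_of_clusterSeparated`).
Census (lane engine `eng/crit6_census.py`, exact enumeration): this criterion is equivalent to NDC on ALL 21 840 rooted connected graphs
on at most five vertices (21 360 satisfy both, 480 neither) and holds for 6 423 of the 6 519 NDC-true rooted graphs of a random sample
on six vertices (never when NDC fails).
Reference: N. Gladkov, arXiv:2408.08457v2 (2024), Thm. 4.3, Def. 4.2, Lemma 3.1, Example 2.5, Thm. 5.2.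
-/

noncomputable section

open Classical

namespace Summit.CriticalPhenomena.PercolationContinuityZ3.Theorems

open MeasureTheory Finset Literature.Probability.LatticeModels Literature.Probability.Percolation
open Literature.Probability.Percolation.DecisionTree Literature.Probability.Percolation.BHK2006
open Literature.Probability.Percolation.TargetExploration Literature.Probability.Percolation.ClusterConditioning

namespace Consts

section General

variable {V : Type*} [Fintype V]

omit [Fintype V] in
/-- Along an open walk of a configuration none of whose pairs meets `K = C_a(ω)`, starting outside `K`, every vertex is outside `K`.
[folklore] -/
theorem not_reachable_of_mem_support (a : V) {ω θ : Set (Sym2 V)}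
    (hθK : ∀ u v, (openGraph θ).Adj u v → ¬ (openGraph ω).Reachable a v) {s t : V} (W : (openGraph θ).Walk s t)
    (hs : ¬ (openGraph ω).Reachable a s) : ∀ x ∈ W.support, ¬ (openGraph ω).Reachable a x := by
  induction W with
  | nil => intro x hx; simp only [SimpleGraph.Walk.support_nil, List.mem_singleton] at hx; exact hx ▸ hs
  | @cons u x v h W ih =>
    intro z hz
    simp only [SimpleGraph.Walk.support_cons, List.mem_cons] at hz
    rcases hz with rfl | hz
    · exact hs
    · exact ih (hθK u x h) z hz

/-- **A `b`-clash forces a branch vertex, with its joining paths** (sharpening of `Consts.exists_branch_of_clash`): under the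
hypotheses there, some vertex `v` outside `K ∪ {a, b, c}` (`K = C_a(ω)`) has at least three `H`-neighbours, is joined to `b` in `ω`,
to `c` in `θ`, and to the clash vertex `y` by an `ω`-walk avoiding `b`. [folklore; combinatorial input for Gladkov2024, Thm. 4.3 / Ex. 2.5] -/
theorem exists_branch_of_clash' (H : SimpleGraph V) [DecidableRel H.Adj] {a b c k y : V} {ω θ : Set (Sym2 V)}
    (hωH : ∀ u v, (openGraph ω).Adj u v → H.Adj u v) (hθH : ∀ u v, (openGraph θ).Adj u v → H.Adj u v)
    (hθK : ∀ u v, (openGraph θ).Adj u v → ¬ (openGraph ω).Reachable a v)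
    (hab : ¬ (openGraph ω).Reachable a b) (hbc : ¬ (openGraph ω).Reachable b c) (hbc' : ¬ (openGraph θ).Reachable b c)
    (hk : (openGraph ω).Reachable a k) (hky : H.Adj k y) (hby : (openGraph ω).Reachable b y)
    (hcy : (openGraph θ).Reachable c y) :
    ∃ v, v ≠ a ∧ v ≠ b ∧ v ≠ c ∧ ¬ (openGraph ω).Reachable a v ∧ 3 ≤ H.degree v ∧ (openGraph ω).Reachable b v ∧
      (openGraph θ).Reachable c v ∧ ∃ W : (openGraph ω).Walk y v, b ∉ W.support := by
  obtain ⟨P₀⟩ := hby.symm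
  obtain ⟨Q⟩ := hcy.symm
  set P := P₀.bypass with hPdef
  have hP : P.IsPath := P₀.bypass_isPath
  -- the vertices of `P` other than its endpoint `b`
  set S : Set V := {v | ∃ i, i < P.length ∧ P.getVert i = v} with hSdef
  have hreachP : ∀ i, (openGraph ω).Reachable y (P.getVert i) := fun i => ⟨P.takeUntil _ (P.getVert_mem_support i)⟩
  have hreachQ : ∀ x ∈ Q.support, (openGraph θ).Reachable y x := fun x hx => ⟨Q.takeUntil x hx⟩
  have hyb : y ≠ b := by rintro rfl; exact hbc' hcy.symm
  have hlen : 0 < P.length := by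
    by_contra h0
    have h0' : P.length = 0 := by omega
    have := P.getVert_length
    rw [h0', P.getVert_zero] at this
    exact hyb this
  have hyS : y ∈ S := ⟨0, hlen, P.getVert_zero⟩
  have hcS : c ∉ S := by
    rintro ⟨i, -, hi⟩
    exact hbc (hby.trans (hi ▸ hreachP i))
  have hPi_notK : ∀ j, ¬ (openGraph ω).Reachable a (P.getVert j) := fun j h =>
    hab (h.trans ((hreachP j).symm.trans hby.symm))
  have hPi_ne_b : ∀ j, j < P.length → P.getVert j ≠ b := by
    intro j hj h
    have := hP.getVert_injOn (by simp only [Set.mem_setOf_eq]; omega) (by simp only [Set.mem_setOf_eq]; exact le_rfl)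
      (h.trans P.getVert_length.symm)
    omega
  -- the `θ`-path from `y` to `c` leaves `S` through a dart `d`; `d.fst = P i`
  obtain ⟨d, hd, hdS, hdS'⟩ := Q.exists_boundary_dart S hyS hcS
  obtain ⟨i, hi, hiv⟩ := hdS
  have hfst_mem : d.fst ∈ Q.support := Q.dart_fst_mem_support_of_mem_darts hd
  have hsnd_reach : (openGraph θ).Reachable y d.snd := hreachQ _ (Q.dart_snd_mem_support_of_mem_darts hd)
  have hsnd_ne_b : d.snd ≠ b := by
    intro h; rw [h] at hsnd_reach; exact hbc' (hsnd_reach.symm.trans hcy.symm)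
  have hsnd_K : ¬ (openGraph ω).Reachable a d.snd := hθK _ _ d.adj
  have hadj_snd : H.Adj (P.getVert i) d.snd := hiv ▸ hθH _ _ d.adj
  have hadj_succ : H.Adj (P.getVert i) (P.getVert (i + 1)) := hωH _ _ (P.adj_getVert_succ hi)
  have hsucc_ne_snd : P.getVert (i + 1) ≠ d.snd := by
    intro h
    by_cases hi1 : i + 1 < P.length
    · exact hdS' ⟨i + 1, hi1, h⟩
    · have hi1' : i + 1 = P.length := by omega
      rw [hi1', P.getVert_length] at h
      exact hsnd_ne_b h.symm
  -- the predecessor of `P i`: `k` if `i = 0`, else `P (i - 1)`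
  obtain ⟨u, hadj_pred, hpred_ne_snd, hpred_ne_succ⟩ :
      ∃ u, H.Adj (P.getVert i) u ∧ u ≠ d.snd ∧ u ≠ P.getVert (i + 1) := by
    by_cases hi0 : i = 0
    · subst hi0
      refine ⟨k, by rw [P.getVert_zero]; exact hky.symm, fun h => hsnd_K (h ▸ hk), fun h => hPi_notK 1 (h ▸ hk)⟩
    · refine ⟨P.getVert (i - 1), ?_, fun h => hdS' ⟨i - 1, by omega, h⟩, fun h => ?_⟩
      · have h := hωH _ _ (P.adj_getVert_succ (show i - 1 < P.length by omega))
        rw [show i - 1 + 1 = i from by omega] at h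
        exact h.symm
      · have := hP.getVert_injOn (by simp only [Set.mem_setOf_eq]; omega) (by simp only [Set.mem_setOf_eq]; omega) h
        omega
  have h3 : ({u, P.getVert (i + 1), d.snd} : Finset V) ⊆ H.neighborFinset (P.getVert i) := by
    intro x hx
    simp only [Finset.mem_insert, Finset.mem_singleton] at hx
    rw [SimpleGraph.mem_neighborFinset]
    rcases hx with rfl | rfl | rfl
    exacts [hadj_pred, hadj_succ, hadj_snd]
  have hcard : ({u, P.getVert (i + 1), d.snd} : Finset V).card = 3 := by
    rw [Finset.card_eq_three]
    exact ⟨u, P.getVert (i + 1), d.snd, hpred_ne_succ, hpred_ne_snd, hsucc_ne_snd, rfl⟩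
  refine ⟨P.getVert i, fun h => hPi_notK i (by rw [h]), hPi_ne_b i hi, fun h => hcS ⟨i, hi, h⟩, hPi_notK i, ?_,
    hby.trans (hreachP i), hcy.trans (hiv ▸ hreachQ _ hfst_mem),
    ⟨P.takeUntil _ (P.getVert_mem_support i), P.endpoint_notMem_support_takeUntil hP _ (hPi_ne_b i hi).symm⟩⟩
  rw [← SimpleGraph.card_neighborFinset_eq_degree, ← hcard]
  exact Finset.card_le_card h3

/-- **No double clash when, for every cluster `K` of `a`, one of the six joinings of the clash/branch vertices is separated.**
For every `K ∋ a` with `b, c ∉ K`, `H`-connected from `a` (certificate: every `T ∋ a` closed under `H`-steps into `K` contains `K`),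
all distinct `y ≠ y'` outside `K ∪ {a, b, c}` with neighbours in `K`, and all distinct `v ≠ v'` outside `K ∪ {a, b, c}` with at
least three neighbours, `v ≠ y'`, `v' ≠ y`, some closed set `S` must certify one of: `v ∤ b` off `K ∪ {c, v', y'}` · `v ∤ c` off
`K ∪ {b, v', y'}` · `v' ∤ c` off `K ∪ {b, v, y}` · `v' ∤ b` off `K ∪ {c, v, y}` · `y ∤ v` off `K ∪ {b, c, v', y'}` · `y' ∤ v'` off
`K ∪ {b, c, v, y}`.  Then the no-double-clash hypothesis of `Consts.clusterSquare_le_sq_of_noDoubleClash_pos` holds for every pair of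
configurations of positive pairs (`H` carrying all positive pairs). [folklore; input for Gladkov2024, Thm. 4.3] -/
theorem not_doubleClash_of_clusterSeparated (H : SimpleGraph V) [DecidableRel H.Adj] (w : Sym2 V → unitInterval) {a b c : V}
    (hH : ∀ u v, u ≠ v → (0 : ℝ) < w s(u, v) → H.Adj u v)
    (hK : ∀ (K : Set V) (y y' v v' : V), a ∈ K → b ∉ K → c ∉ K →
      (∀ T : Set V, a ∈ T → (∀ u x, u ∈ T → H.Adj u x → x ∈ K → x ∈ T) → K ⊆ T) →
      y ∉ K → y' ∉ K → (∃ k, k ∈ K ∧ H.Adj k y) → (∃ k, k ∈ K ∧ H.Adj k y') →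
      y ≠ a → y ≠ b → y ≠ c → y' ≠ a → y' ≠ b → y' ≠ c → y ≠ y' →
      v ∉ K → v' ∉ K → v ≠ a → v ≠ b → v ≠ c → v' ≠ a → v' ≠ b → v' ≠ c → v ≠ v' → v ≠ y' → v' ≠ y →
      3 ≤ H.degree v → 3 ≤ H.degree v' →
      ∃ S : Set V,
        (v ∈ S ∧ b ∉ S ∧ ∀ u x, u ∈ S → H.Adj u x → x ∉ K → x ≠ c → x ≠ v' → x ≠ y' → x ∈ S) ∨
        (v ∈ S ∧ c ∉ S ∧ ∀ u x, u ∈ S → H.Adj u x → x ∉ K → x ≠ b → x ≠ v' → x ≠ y' → x ∈ S) ∨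
        (v' ∈ S ∧ c ∉ S ∧ ∀ u x, u ∈ S → H.Adj u x → x ∉ K → x ≠ b → x ≠ v → x ≠ y → x ∈ S) ∨
        (v' ∈ S ∧ b ∉ S ∧ ∀ u x, u ∈ S → H.Adj u x → x ∉ K → x ≠ c → x ≠ v → x ≠ y → x ∈ S) ∨
        (y ∈ S ∧ v ∉ S ∧ ∀ u x, u ∈ S → H.Adj u x → x ∉ K → x ≠ b → x ≠ c → x ≠ v' → x ≠ y' → x ∈ S) ∨
        (y' ∈ S ∧ v' ∉ S ∧ ∀ u x, u ∈ S → H.Adj u x → x ∉ K → x ≠ b → x ≠ c → x ≠ v → x ≠ y → x ∈ S))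
    {ω η : Set (Sym2 V)} (hω : ∀ e ∈ ω, (0 : ℝ) < w e) (hη : ∀ e ∈ η, (0 : ℝ) < w e)
    (hab : ¬ (openGraph ω).Reachable a b) (hac : ¬ (openGraph ω).Reachable a c) (hbc : ¬ (openGraph ω).Reachable b c)
    (hbc' : ¬ (openGraph (η \ barOf {a} (setCl ω {a}))).Reachable b c) :
    ¬ ((∃ y k : V, (openGraph ω).Reachable a k ∧ (0 : ℝ) < w s(k, y) ∧ (openGraph ω).Reachable b y ∧
          (openGraph (η \ barOf {a} (setCl ω {a}))).Reachable c y) ∧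
       (∃ y k : V, (openGraph ω).Reachable a k ∧ (0 : ℝ) < w s(k, y) ∧ (openGraph ω).Reachable c y ∧
          (openGraph (η \ barOf {a} (setCl ω {a}))).Reachable b y)) := by
  rintro ⟨⟨y, k, hk, hw, hby, hcy⟩, ⟨y', k', hk', hw', hcy', hby'⟩⟩
  set θ := η \ barOf {a} (setCl ω {a}) with hθdef
  set K : Set V := {x | (openGraph ω).Reachable a x} with hKdef
  have hadjH : ∀ (ξ : Set (Sym2 V)), (∀ e ∈ ξ, (0 : ℝ) < w e) → ∀ u v, (openGraph ξ).Adj u v → H.Adj u v := by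
    intro ξ hξ u v huv
    rw [openGraph_adj] at huv
    exact hH u v huv.2 (hξ _ huv.1)
  have hθ : ∀ e ∈ θ, (0 : ℝ) < w e := fun e he => hη e he.1
  have hθK : ∀ u v, (openGraph θ).Adj u v → ¬ (openGraph ω).Reachable a v := by
    intro u v huv hav
    rw [openGraph_adj, hθdef, barOf_setCl_singleton_eq_cutSet] at huv
    exact huv.1.2 ⟨v, Sym2.mem_mk_right u v, hav⟩
  have hky : H.Adj k y := hH k y (fun h => hab (hk.trans (h ▸ hby.symm))) hw
  have hky' : H.Adj k' y' := hH k' y' (fun h => hac (hk'.trans (h ▸ hcy'.symm))) hw'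
  obtain ⟨v, hva, hvb, hvc, hvK, hdv, hbv, hcv, ⟨W, hWb⟩⟩ := exists_branch_of_clash' H (hadjH ω hω) (hadjH _ hθ) hθK hab hbc hbc'
    hk hky hby hcy
  obtain ⟨v', hva', hvc', hvb', hvK', hdv', hcv', hbv', ⟨W', hWc⟩⟩ := exists_branch_of_clash' H (hadjH ω hω) (hadjH _ hθ) hθK
    hac (fun h => hbc h.symm) (fun h => hbc' h.symm) hk' hky' hcy' hby'
  -- the data satisfy the conditions of `hK`
  have hyK : y ∉ K := fun h => hab (h.trans hby.symm)
  have hyK' : y' ∉ K := fun h => hac (h.trans hcy'.symm)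
  have hconn : ∀ T : Set V, a ∈ T → (∀ u x, u ∈ T → H.Adj u x → x ∈ K → x ∈ T) → K ⊆ T := by
    intro T haT hT x hx
    obtain ⟨X⟩ := id hx
    exact mem_of_openWalk_adm H T (fun z => z ∈ K) (fun u z hu huz hz => hT u z hu huz hz) (hadjH ω hω) X haT
      fun z hz => Or.inr (show (openGraph ω).Reachable a z from ⟨X.takeUntil z hz⟩)
  have hωx : ∀ {s t : V} (X : (openGraph ω).Walk s t) (x : V), x ∈ X.support → (openGraph ω).Reachable s x :=
    fun X x hx => ⟨X.takeUntil x hx⟩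
  have hθx : ∀ {s t : V} (X : (openGraph θ).Walk s t) (x : V), x ∈ X.support → (openGraph θ).Reachable s x :=
    fun X x hx => ⟨X.takeUntil x hx⟩
  obtain ⟨S, hS⟩ := hK K y y' v v' (SimpleGraph.Reachable.refl a) hab hac hconn hyK hyK' ⟨k, hk, hky⟩ ⟨k', hk', hky'⟩
    (fun h => hyK (by rw [h]; exact SimpleGraph.Reachable.refl a)) (fun h => hbc' (by rw [← h]; exact hcy.symm))
    (fun h => hbc (by rw [← h]; exact hby)) (fun h => hyK' (by rw [h]; exact SimpleGraph.Reachable.refl a))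
    (fun h => hbc (by rw [← h]; exact hcy'.symm)) (fun h => hbc' (by rw [← h]; exact hby'))
    (fun h => hbc (hby.trans (by rw [h]; exact hcy'.symm))) hvK hvK' hva hvb hvc hva' hvb' hvc'
    (fun h => hbc (hbv.trans (by rw [h]; exact hcv'.symm))) (fun h => hbc (hbv.trans (by rw [h]; exact hcy'.symm)))
    (fun h => hbc (hby.trans (by rw [← h]; exact hcv'.symm))) hdv hdv'
  rcases hS with ⟨hvS, hbS, hcl⟩ | ⟨hvS, hcS, hcl⟩ | ⟨hvS, hcS, hcl⟩ | ⟨hvS, hbS, hcl⟩ | ⟨hyS, hvS, hcl⟩ | ⟨hyS, hvS, hcl⟩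
  · -- `v ∤ b` off `K ∪ {c, v', y'}`: contradicted by the `ω`-walk from `v` to `b` inside `C_b(ω)`
    obtain ⟨X⟩ := hbv.symm
    refine hbS (mem_of_openWalk_adm H S (fun x => x ∉ K ∧ x ≠ c ∧ x ≠ v' ∧ x ≠ y')
      (fun u x hu hux hx => hcl u x hu hux hx.1 hx.2.1 hx.2.2.1 hx.2.2.2) (hadjH ω hω) X hvS fun x hx => Or.inr ?_)
    have hbx : (openGraph ω).Reachable b x := hbv.trans (hωx X x hx)
    exact ⟨fun h => hab (h.trans hbx.symm), fun h => hbc (by rw [← h]; exact hbx),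
      fun h => hbc (hbx.trans (by rw [h]; exact hcv'.symm)), fun h => hbc (hbx.trans (by rw [h]; exact hcy'.symm))⟩
  · -- `v ∤ c` off `K ∪ {b, v', y'}`: contradicted by the `θ`-walk from `v` to `c` inside `C_c(θ)`
    obtain ⟨X⟩ := hcv.symm
    have hXK := not_reachable_of_mem_support a hθK X hvK
    refine hcS (mem_of_openWalk_adm H S (fun x => x ∉ K ∧ x ≠ b ∧ x ≠ v' ∧ x ≠ y')
      (fun u x hu hux hx => hcl u x hu hux hx.1 hx.2.1 hx.2.2.1 hx.2.2.2) (hadjH _ hθ) X hvS fun x hx => Or.inr ?_)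
    have hcx : (openGraph θ).Reachable c x := hcv.trans (hθx X x hx)
    exact ⟨hXK x hx, fun h => hbc' (by rw [← h]; exact hcx.symm),
      fun h => hbc' (hbv'.trans (by rw [← h]; exact hcx.symm)), fun h => hbc' (hby'.trans (by rw [← h]; exact hcx.symm))⟩
  · -- `v' ∤ c` off `K ∪ {b, v, y}`: contradicted by the `ω`-walk from `v'` to `c` inside `C_c(ω)`
    obtain ⟨X⟩ := hcv'.symm
    refine hcS (mem_of_openWalk_adm H S (fun x => x ∉ K ∧ x ≠ b ∧ x ≠ v ∧ x ≠ y)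
      (fun u x hu hux hx => hcl u x hu hux hx.1 hx.2.1 hx.2.2.1 hx.2.2.2) (hadjH ω hω) X hvS fun x hx => Or.inr ?_)
    have hcx : (openGraph ω).Reachable c x := hcv'.trans (hωx X x hx)
    exact ⟨fun h => hac (h.trans hcx.symm), fun h => hbc (by rw [← h]; exact hcx.symm),
      fun h => hbc (hbv.trans (by rw [← h]; exact hcx.symm)), fun h => hbc (hby.trans (by rw [← h]; exact hcx.symm))⟩
  · -- `v' ∤ b` off `K ∪ {c, v, y}`: contradicted by the `θ`-walk from `v'` to `b` inside `C_b(θ)`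
    obtain ⟨X⟩ := hbv'.symm
    have hXK := not_reachable_of_mem_support a hθK X hvK'
    refine hbS (mem_of_openWalk_adm H S (fun x => x ∉ K ∧ x ≠ c ∧ x ≠ v ∧ x ≠ y)
      (fun u x hu hux hx => hcl u x hu hux hx.1 hx.2.1 hx.2.2.1 hx.2.2.2) (hadjH _ hθ) X hvS fun x hx => Or.inr ?_)
    have hbx : (openGraph θ).Reachable b x := hbv'.trans (hθx X x hx)
    exact ⟨hXK x hx, fun h => hbc' (by rw [← h]; exact hbx),
      fun h => hbc' (hbx.trans (by rw [h]; exact hcv.symm)), fun h => hbc' (hbx.trans (by rw [h]; exact hcy.symm))⟩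
  · -- `y ∤ v` off `K ∪ {b, c, v', y'}`: contradicted by the initial segment `W` of the clash path (inside `C_b(ω)`, avoiding `b`)
    refine hvS (mem_of_openWalk_adm H S (fun x => x ∉ K ∧ x ≠ b ∧ x ≠ c ∧ x ≠ v' ∧ x ≠ y')
      (fun u x hu hux hx => hcl u x hu hux hx.1 hx.2.1 hx.2.2.1 hx.2.2.2.1 hx.2.2.2.2) (hadjH ω hω) W hyS fun x hx => Or.inr ?_)
    have hbx : (openGraph ω).Reachable b x := hby.trans (hωx W x hx)
    exact ⟨fun h => hab (h.trans hbx.symm), fun h => hWb (h ▸ hx), fun h => hbc (by rw [← h]; exact hbx),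
      fun h => hbc (hbx.trans (by rw [h]; exact hcv'.symm)), fun h => hbc (hbx.trans (by rw [h]; exact hcy'.symm))⟩
  · -- `y' ∤ v'` off `K ∪ {b, c, v, y}`: contradicted by the initial segment `W'` of the second clash path (inside `C_c(ω)`)
    refine hvS (mem_of_openWalk_adm H S (fun x => x ∉ K ∧ x ≠ b ∧ x ≠ c ∧ x ≠ v ∧ x ≠ y)
      (fun u x hu hux hx => hcl u x hu hux hx.1 hx.2.1 hx.2.2.1 hx.2.2.2.1 hx.2.2.2.2) (hadjH ω hω) W' hyS fun x hx => Or.inr ?_)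
    have hcx : (openGraph ω).Reachable c x := hcy'.trans (hωx W' x hx)
    exact ⟨fun h => hac (h.trans hcx.symm), fun h => hbc (by rw [← h]; exact hcx.symm), fun h => hWc (h ▸ hx),
      fun h => hbc (hbv.trans (by rw [← h]; exact hcx.symm)), fun h => hbc (hby.trans (by rw [← h]; exact hcx.symm))⟩

end General

/-! ### `Fin n` forms -/

section Fin

variable {n : ℕ} (w : Sym2 (Fin n) → unitInterval) (a b c : Fin n) (H : SimpleGraph (Fin n)) [DecidableRel H.Adj]

/-- **CSQ at `(a; b, c)` under the cluster-wise separation criterion** (hypotheses as in `Consts.not_doubleClash_of_clusterSeparated`):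
`clusterSquare w a b c ≤ μ(b ↮ c)²`. [cite: Gladkov2024, Thm. 4.3, Def. 4.2, Lemma 3.1, Ex. 2.5] -/
theorem clusterSquare_le_sq_of_clusterSeparated (hH : ∀ u v, u ≠ v → (0 : ℝ) < w s(u, v) → H.Adj u v)
    (hK : ∀ (K : Set (Fin n)) (y y' v v' : Fin n), a ∈ K → b ∉ K → c ∉ K →
      (∀ T : Set (Fin n), a ∈ T → (∀ u x, u ∈ T → H.Adj u x → x ∈ K → x ∈ T) → K ⊆ T) →
      y ∉ K → y' ∉ K → (∃ k, k ∈ K ∧ H.Adj k y) → (∃ k, k ∈ K ∧ H.Adj k y') →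
      y ≠ a → y ≠ b → y ≠ c → y' ≠ a → y' ≠ b → y' ≠ c → y ≠ y' →
      v ∉ K → v' ∉ K → v ≠ a → v ≠ b → v ≠ c → v' ≠ a → v' ≠ b → v' ≠ c → v ≠ v' → v ≠ y' → v' ≠ y →
      3 ≤ H.degree v → 3 ≤ H.degree v' →
      ∃ S : Set (Fin n),
        (v ∈ S ∧ b ∉ S ∧ ∀ u x, u ∈ S → H.Adj u x → x ∉ K → x ≠ c → x ≠ v' → x ≠ y' → x ∈ S) ∨
        (v ∈ S ∧ c ∉ S ∧ ∀ u x, u ∈ S → H.Adj u x → x ∉ K → x ≠ b → x ≠ v' → x ≠ y' → x ∈ S) ∨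
        (v' ∈ S ∧ c ∉ S ∧ ∀ u x, u ∈ S → H.Adj u x → x ∉ K → x ≠ b → x ≠ v → x ≠ y → x ∈ S) ∨
        (v' ∈ S ∧ b ∉ S ∧ ∀ u x, u ∈ S → H.Adj u x → x ∉ K → x ≠ c → x ≠ v → x ≠ y → x ∈ S) ∨
        (y ∈ S ∧ v ∉ S ∧ ∀ u x, u ∈ S → H.Adj u x → x ∉ K → x ≠ b → x ≠ c → x ≠ v' → x ≠ y' → x ∈ S) ∨
        (y' ∈ S ∧ v' ∉ S ∧ ∀ u x, u ∈ S → H.Adj u x → x ∉ K → x ≠ b → x ≠ c → x ≠ v → x ≠ y → x ∈ S)) :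
    clusterSquare w a b c ≤ (prodBernoulli w).real (openConn b c)ᶜ ^ 2 :=
  clusterSquare_le_sq_of_noDoubleClash_pos w a b c fun _ _ hω hη hab hac hbc hbc' =>
    not_doubleClash_of_clusterSeparated H w hH hK hω hη hab hac hbc hbc'

/-- **DUU at `(a; b, c)` under the cluster-wise separation criterion.** [cite: Gladkov2024, Thm. 5.2 and Thm. 4.3] -/
theorem sq_real_split_le_of_clusterSeparated (hH : ∀ u v, u ≠ v → (0 : ℝ) < w s(u, v) → H.Adj u v)
    (hK : ∀ (K : Set (Fin n)) (y y' v v' : Fin n), a ∈ K → b ∉ K → c ∉ K →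
      (∀ T : Set (Fin n), a ∈ T → (∀ u x, u ∈ T → H.Adj u x → x ∈ K → x ∈ T) → K ⊆ T) →
      y ∉ K → y' ∉ K → (∃ k, k ∈ K ∧ H.Adj k y) → (∃ k, k ∈ K ∧ H.Adj k y') →
      y ≠ a → y ≠ b → y ≠ c → y' ≠ a → y' ≠ b → y' ≠ c → y ≠ y' →
      v ∉ K → v' ∉ K → v ≠ a → v ≠ b → v ≠ c → v' ≠ a → v' ≠ b → v' ≠ c → v ≠ v' → v ≠ y' → v' ≠ y →
      3 ≤ H.degree v → 3 ≤ H.degree v' →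
      ∃ S : Set (Fin n),
        (v ∈ S ∧ b ∉ S ∧ ∀ u x, u ∈ S → H.Adj u x → x ∉ K → x ≠ c → x ≠ v' → x ≠ y' → x ∈ S) ∨
        (v ∈ S ∧ c ∉ S ∧ ∀ u x, u ∈ S → H.Adj u x → x ∉ K → x ≠ b → x ≠ v' → x ≠ y' → x ∈ S) ∨
        (v' ∈ S ∧ c ∉ S ∧ ∀ u x, u ∈ S → H.Adj u x → x ∉ K → x ≠ b → x ≠ v → x ≠ y → x ∈ S) ∨
        (v' ∈ S ∧ b ∉ S ∧ ∀ u x, u ∈ S → H.Adj u x → x ∉ K → x ≠ c → x ≠ v → x ≠ y → x ∈ S) ∨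
        (y ∈ S ∧ v ∉ S ∧ ∀ u x, u ∈ S → H.Adj u x → x ∉ K → x ≠ b → x ≠ c → x ≠ v' → x ≠ y' → x ∈ S) ∨
        (y' ∈ S ∧ v' ∉ S ∧ ∀ u x, u ∈ S → H.Adj u x → x ∉ K → x ≠ b → x ≠ c → x ≠ v → x ≠ y → x ∈ S)) :
    (prodBernoulli w).real ((openConn a b)ᶜ ∩ (openConn a c)ᶜ ∩ (openConn b c)ᶜ) ^ 2 ≤
      (prodBernoulli w).real ((openConn a b)ᶜ ∩ (openConn a c)ᶜ) * (prodBernoulli w).real (openConn b c)ᶜ ^ 2 :=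
  sq_real_split_le_of_noDoubleClash_pos w a b c fun _ _ hω hη hab hac hbc hbc' =>
    not_doubleClash_of_clusterSeparated H w hH hK hω hη hab hac hbc hbc'

/-- **TS for `{a, b, c}` under the cluster-wise separation criterion** (root `a`):
`μ(a ↮ b, a ↮ c, b ↮ c)² ≤ μ(a ↮ b) μ(a ↮ c) μ(b ↮ c)`. [cite: Gladkov2024, Thm. 5.2, Cor. 5.3 (pattern) and Thm. 4.3] -/
theorem tripleSplit_of_clusterSeparated (hH : ∀ u v, u ≠ v → (0 : ℝ) < w s(u, v) → H.Adj u v)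
    (hK : ∀ (K : Set (Fin n)) (y y' v v' : Fin n), a ∈ K → b ∉ K → c ∉ K →
      (∀ T : Set (Fin n), a ∈ T → (∀ u x, u ∈ T → H.Adj u x → x ∈ K → x ∈ T) → K ⊆ T) →
      y ∉ K → y' ∉ K → (∃ k, k ∈ K ∧ H.Adj k y) → (∃ k, k ∈ K ∧ H.Adj k y') →
      y ≠ a → y ≠ b → y ≠ c → y' ≠ a → y' ≠ b → y' ≠ c → y ≠ y' →
      v ∉ K → v' ∉ K → v ≠ a → v ≠ b → v ≠ c → v' ≠ a → v' ≠ b → v' ≠ c → v ≠ v' → v ≠ y' → v' ≠ y →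
      3 ≤ H.degree v → 3 ≤ H.degree v' →
      ∃ S : Set (Fin n),
        (v ∈ S ∧ b ∉ S ∧ ∀ u x, u ∈ S → H.Adj u x → x ∉ K → x ≠ c → x ≠ v' → x ≠ y' → x ∈ S) ∨
        (v ∈ S ∧ c ∉ S ∧ ∀ u x, u ∈ S → H.Adj u x → x ∉ K → x ≠ b → x ≠ v' → x ≠ y' → x ∈ S) ∨
        (v' ∈ S ∧ c ∉ S ∧ ∀ u x, u ∈ S → H.Adj u x → x ∉ K → x ≠ b → x ≠ v → x ≠ y → x ∈ S) ∨
        (v' ∈ S ∧ b ∉ S ∧ ∀ u x, u ∈ S → H.Adj u x → x ∉ K → x ≠ c → x ≠ v → x ≠ y → x ∈ S) ∨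
        (y ∈ S ∧ v ∉ S ∧ ∀ u x, u ∈ S → H.Adj u x → x ∉ K → x ≠ b → x ≠ c → x ≠ v' → x ≠ y' → x ∈ S) ∨
        (y' ∈ S ∧ v' ∉ S ∧ ∀ u x, u ∈ S → H.Adj u x → x ∉ K → x ≠ b → x ≠ c → x ≠ v → x ≠ y → x ∈ S)) :
    (prodBernoulli w).real ((openConn a b)ᶜ ∩ (openConn a c)ᶜ ∩ (openConn b c)ᶜ) ^ 2 ≤
      (prodBernoulli w).real (openConn a b)ᶜ * (prodBernoulli w).real (openConn a c)ᶜ *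
        (prodBernoulli w).real (openConn b c)ᶜ :=
  tripleSplit_of_noDoubleClash_pos w a b c fun _ _ hω hη hab hac hbc hbc' =>
    not_doubleClash_of_clusterSeparated H w hH hK hω hη hab hac hbc hbc'

end Fin

end Consts

end Summit.CriticalPhenomena.PercolationContinuityZ3.Theorems
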